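import Literature.AnabelianGeometry.SemiGraphs.FiniteEtaleCoveringDictionaryProofs2c
import HarnessLib

/-!
# The finite étale covering dictionary ([SemiAnbd] §2) — (D2) closed

Mochizuki, *Semi-graphs of anabelioids*, Publ. RIMS **42** (2006), §2 p. 23 / Remark 2.2.1 p. 24.
abc-iut cell, layer L3, row G30 (D2): with the dictionary's `covering_vertexFibre_doubleCosets` in the
UNTIED form of ruling ψ2 (dictionary v4a), the named fact is exactly abc-iut-L6-d4's
`covering_vertexFibre_doubleCosets_untied` (`FiniteEtaleCoveringDictionaryProofs2c.lean`, over the core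
`…Proofs2b.lean`).  PROOF-ONLY file.  Nothing here takes a side on [IUTchIII] Cor. 3.12.
-/

namespace Literature.AnabelianGeometry.SemiGraphs

namespace SemiGraphOfAnabelioids

universe v₁ u₁ u

/-- **(D2) `covering_vertexFibre_doubleCosets` DISCHARGED** ([SemiAnbd] §2 p. 23, Rem. 2.2.1 p. 24):
the vertices of the covering over `v` ↔ `Π_v \ Π_𝒢 / Π′`, base vertex on the class of `1`,
`ι(Π_{v′}) = Π′ ∩ Π_v`, and every verticial subgroup over `v` is a decomposition group
`Π′ ∩ g⁻¹ Π_v g` — for coverings that are local ∧ global ∧ vertex-aligned.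
[cite: MochizukiSemiAnbd2006, Rem. 2.2.1 p.24] -/
theorem covering_vertexFibre_doubleCosets_holds : covering_vertexFibre_doubleCosets.{v₁, u₁, u} :=
  covering_vertexFibre_doubleCosets_untied

end SemiGraphOfAnabelioids

end Literature.AnabelianGeometry.SemiGraphs
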